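/-
COR-CM (cells pub-hodgecm / pub-hodgecm2, stage 2 of the Hodge ladder) — TRANSPOSITION item (vi), S-LANE «PHASE C»: the END display with the ALBANESE CITE RETIRED. The re-cut ladder p317049 `…RestOne` → p320155 `…RestOneHecke` → p320321/p321050 `…RestOneOmega(Hecke)` →
p323209 `…RestOnePlugged` → p325278 `…RestOnePluggedR` → «BUILT-R» `…RestOneBuiltR` consumes the Albanese cite `hA : albanese_baseChange_isLimit_fan_jacobian` (decited to `hAb : Liu2021.albanese_baseChange` at BUILT-R) AT ITS BASE (p317049 §1 :162, through pin-3's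
`faceSupply_of_thm418AsPrinted_glue_unif_along … (hUnif_holds h) (hAlb_holds hA …)`), so no further ONE-APPLICATION re-cut can shed it (pin-1 g4's cost map, HOME/INBOX l.8157).  This file is the FLATTENED re-derivation the lead assigned to own-htheta (l.8162, «draft phase
C»): §0 = p317049 §1 VERBATIM with the binder `hA` DELETED and the ONE consuming line re-pointed — pin-2's along-junction `faceSupply_of_thm418AsPrinted_pinned_isog_along` called directly with `hReach :=` TEAM hComp's hA-FREE closed reach `Model.pinReachEpi_closed h₁ h₃ h
iso C R` (S8 `HComp/PinReachEpi.lean`, hcomp-abcm-1 / pin-1: pin-1's reach chain re-typed from «product (limit fan)» to «jointly epimorphic Albanese family», fed by `hUnif_holds h` [Deligne 1979, 2.1.2 / 2.2.5 / Cor. 2.7.21 behind the record `h`] and the THEOREM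
`hAlbEpi_holds_conj` (S7 `HComp/HAlbEpiHolds.lean`, [Liu2021] §2.1 Prop. 2.2 proved in the tree — NO named fact)); §0H = p320155 §1 (the Hecke layer, `dif`-on-`6 ≤ [F:ℚ]` device) VERBATIM minus `hA`, re-pointed at §0; §1 = §0H at EVERY remaining plug of the ladder by the
SAME tree names, ONE APPLICATION; §2 = the meeting form.  EFFECT ON THE DISPLAY of BUILT-R §2 (5 named + hM): `hAb` GONE; NOTHING new displayed ⇒ 4 NAMED {h; hLiu; h21; hirr} + hM, no posited data.  Still ASSUMED: the published theorems `h` [Deligne1979 2.1.2/2.2.5 — the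
canonical-model RECORD; hComp stays conditional on it], `h21` [Shimura1998 Thm. 21.4], `hLiu` [Liu2021 Thm. 4.18 at the CONSTRUCTED system/objects/action; (W3)/(W1) residuals as at BUILT-R], the reading `hirr` [Liu2021 Def. 4.11 / Lem. D.1 (1)], and the B01-O meeting
binder `hM`. Seat prover-pub-hodgecm-own-htheta-g5-0 (own-htheta gen 5, S2-CRUX owner), DRAFTING pen; FILING pen = pin-3 g4 after S8 ✔ and after BUILT-R has landed and been read (lead l.8162).  Theorems only (four); no definition, no instance, no named fact, no
`variable`; nothing landed is edited or restated (NEW path, FILE-ONCE). POINTER: label only under the lead's clause (i′).  FRAMING: HC_CM is NOT proved; S2 = B01-S is NOT inhabited — the display is CONDITIONAL on published theorems entered as hypotheses and on hM; the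
socket `FaceThetaDataExists` stays uninhabited.
FILING (pin-3 gen 4, prover-pub-hodgecm2-pin-3-g4-0 = FILING pen of PHASE C per lead gen 9 HOME/INBOX l.8162; DRAFTING pen own-htheta g5): from the first `import` to EOF these bytes are own-htheta g5's staged draft
`g5/lean/Item6SupplyPinnedAssemblyAlongHoldsRestOneBuiltEpi.draft.lean` md5 717a5b615462 VERBATIM (x2 g8 sorry-free as-staged certificate HOME/INBOX l.8251); this header = the draft's header re-wrapped + this sentence (the 400-line rule). Predecessor display of record on
this chain: «BUILT-R» = p326199 `Transposition/Item6SupplyPinnedAssemblyAlongHoldsRestOneBuiltR.lean` (commit 5bf50153ed70, 5 NAMED {h, hAb; hLiu; h21; hirr} + hM).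
-/
import Summits.HodgeConjecture.CorCM.B01.Transposition.Item6SupplyPinnedAssemblyAlongHoldsRestOnePluggedR
import Summits.HodgeConjecture.CorCM.B01.Transposition.HComp.HeckeTranslatesOfSec42DataOf
import Summits.HodgeConjecture.CorCM.B01.Transposition.HComp.PinReachEpi
import Literature.AlgebraicGeometry.ShimuraVarieties.UnitaryShimuraCanonicalModelHeckeHolds
import HarnessLib

set_option autoImplicit false

/-!
# B01-S and the (β)-free END display with EVERY Liu carrier CONSTRUCTED and the Albanese cite RETIRED (phase C, flattened)

§0 `Model.faceSupply_of_thm418AsPrinted_along_conj_holds_restOne_epi` — p317049 §1 (`…_restOne`) with `hA` deleted: B01-S at the one-object rest over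
GENERAL posited carriers `iso / C / P / Eps / epsOf / Chi / omega / rho / rhoΩ`, reach from `Model.pinReachEpi_closed`.
§0H `Model.faceSupply_of_thm418AsPrinted_along_conj_holds_restOne_hecke_epi` — p320155 §1 (`…_restOne_hecke`) with `hA` deleted, on §0.
§1 `Model.faceSupply_of_thm418AsPrinted_along_conj_holds_restOne_builtEpi` — §0H at the ladder's plugs, ONE application (BUILT-R §1's statement minus `hAb`).
§2 `Model.hc_cm_of_thm418AsPrinted_along_conj_holds_restOne_builtEpi_meeting_rec` — meeting form on `U_rec` (BUILT-R §2's statement minus `hAb`):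
END DISPLAY 4 NAMED {h; hLiu; h21; hirr} + hM.  HC_CM is NOT proved.

References as in `…RestOnePluggedR.lean` / `HComp/PinReachEpi.lean`.
-/

noncomputable section

open scoped TensorProduct InnerProductSpace Kronecker

namespace Summit.HodgeConjecture.CorCM.Model

open CategoryTheory CategoryTheory.Limits AlgebraicGeometry NumberField
open Literature.AlgebraicGeometry.Motives
open Literature.AlgebraicGeometry.HodgeTheory
open Literature.AlgebraicGeometry.ShimuraVarieties
open Literature.AlgebraicGeometry.ShimuraVarieties.UnitaryCanonicalModel
open Literature.AlgebraicGeometry.ComplexMultiplication (IsCMTypeRealisation)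
open Literature.NumberTheory.ComplexMultiplication
open Literature.NumberTheory.Automorphic
open Literature.NumberTheory.Automorphic.IdeleClassGroup
open Literature.NumberTheory.Automorphic.PicardCM
open Literature.NumberTheory.Automorphic.Liu2021
open Literature.NumberTheory.Automorphic.Liu2021.AppendixC
open Literature.NumberTheory.Automorphic.Liu2021.AppendixC.RestOne
open Literature.NumberTheory.Automorphic.Liu2021.Def411WeilCarriers (JW TW isSymm_TW isUnit_det_TW JW_eq)
open Literature.NumberTheory.GelbartRogawski1991 Literature.NumberTheory.GelbartRogawski1991.UnitaryDualPair
open Literature.NumberTheory.Weil1964 Literature.RepresentationTheory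
open Summit.HodgeConjecture.CorCM.Transposition

/-! ## §0  B01-S at the one-object rest over GENERAL carriers, reach WITHOUT the Albanese cite (p317049 §1 minus `hA`) -/

/-- **B01-S from [Liu2021, Thm. 4.18] AS PRINTED at `R := restOne …` with `μ := μ(Φ, ι₁)`, WITHOUT the Albanese cite** (`U = picardCMUniverse hHD hI h₁ h₃`):
pin-3's `faceSupply_of_thm418AsPrinted_along_conj_holds_restOne` (p317049 §1) with the binder `hA : albanese_baseChange_isLimit_fan_jacobian` DELETED — statement
otherwise VERBATIM, proof VERBATIM except the one consuming line: pin-2's `faceSupply_of_thm418AsPrinted_pinned_isog_along` is called directly (pin-3's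
`…glue_unif_along` minus its FAN-typed `hAlb`) with `hReach := pinReachEpi_closed h₁ h₃ h iso C R` (TEAM hComp S8: `hUnif_holds h` + the theorem `hAlbEpi_holds_conj`).
Displayed: the cite `h` ([Deligne1979] 2.1.2/2.2.5 record), the posited carriers `iso`, `C`, `P`, `Eps`, `epsOf`, `Chi`, `omega` (+ two instance families), `rho`,
`rhoΩ`, the readings `hLiu` ([Liu2021] Thm. 4.18 at the rest), `hObj` (Prop. 4.6 (1)), `hChi`, `hirr`, `hsm`.  HC_CM is NOT proved; nothing is inhabited here.
[cite: Liu2021, Thm. 4.18 (FJcycle.tex l. 2232–2245), Prop. 4.6 (1) (l. 1969), Def. 4.5 (2) (l. 1944–1958), §4.2 l. 2053–2074, §2.1 Prop. 2.2 (l. 1190–1200) and Prop. C.5 (l. 4627–4637)]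
[cite: Deligne1979ShimuraVarieties, §2.1.2, 2.2.5 and Cor. 2.7.21] -/

theorem faceSupply_of_thm418AsPrinted_along_conj_holds_restOne_epi
    (hHD : exists_isReal_hodgeModel) (hI : hodgePQ_independent_of_hodgeModel)
    (h₁ : BallQuotientUniformised) (h₃ : CMAbelianVarietyRealised)
    (h : exists_recordSystem)
    (iso : ∀ (F : CMField) (ι₁ : F →+* ℂ) (_ : HermSpace3 F ι₁) (_ : CMType F), ℕ → Prop)
    (C : ∀ (F : CMField) (ι₁ : F →+* ℂ) (V : HermSpace3 F ι₁) (Φ : CMType F), Sec42Data (honestP5Of h F ι₁ V Φ) (iso F ι₁ V Φ))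
    (P : ∀ (F : CMField) [IsGalois ℚ F] (ι₁ : F →+* ℂ) (_ : HermSpace3 F ι₁) (Φ : CMType F) (A : AbelianVariety F),
      (muAlgValueField F (muOfInvType ι₁ Φ) →+* A.endAlgebra) → Type)
    (Eps : ∀ (F : CMField) (ι₁ : F →+* ℂ) (_ : HermSpace3 F ι₁) (_ : CMType F), Type)
    (epsOf : ∀ (F : CMField) (ι₁ : F →+* ℂ) (V : HermSpace3 F ι₁) (Φ : CMType F), F → Eps F ι₁ V Φ)
    (Chi : ∀ (F : CMField) (ι₁ : F →+* ℂ) (_ : HermSpace3 F ι₁) (_ : CMType F), Type)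
    (omega : ∀ (F : CMField) (ι₁ : F →+* ℂ) (V : HermSpace3 F ι₁) (Φ : CMType F), Eps F ι₁ V Φ → Chi F ι₁ V Φ → Type)
    [instACG : ∀ (F : CMField) (ι₁ : F →+* ℂ) (V : HermSpace3 F ι₁) (Φ : CMType F) (ε : Eps F ι₁ V Φ) (χ : Chi F ι₁ V Φ),
      AddCommGroup (omega F ι₁ V Φ ε χ)]
    [instMod : ∀ (F : CMField) (ι₁ : F →+* ℂ) (V : HermSpace3 F ι₁) (Φ : CMType F) (ε : Eps F ι₁ V Φ) (χ : Chi F ι₁ V Φ),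
      Module ℂ (omega F ι₁ V Φ ε χ)]
    (rho : ∀ (F : CMField) (ι₁ : F →+* ℂ) (V : HermSpace3 F ι₁) (Φ : CMType F) (ε : Eps F ι₁ V Φ) (χ : Chi F ι₁ V Φ),
      Representation ℂ (C F ι₁ V Φ).G (omega F ι₁ V Φ ε χ))
    (rhoΩ : ∀ (F : CMField) [IsGalois ℚ F] (ι₁ : F →+* ℂ) (V : HermSpace3 F ι₁) (Φ : CMType F),
      Representation (fieldOfValues F (muOfInvType ι₁ Φ)) (C F ι₁ V Φ).G
        (ΩOne (C F ι₁ V Φ) (AlgHom.id ℚ F) ι₁ (isConjugateSymplectic_muOfInvType ι₁ Φ) (hasWeight_one_muOfInvType ι₁ Φ) (Def45.Carriers.ofPolDR (muOfInvType ι₁ Φ) (P F ι₁ V Φ))))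
    (hLiu : ∀ (F : CMField) [IsGalois ℚ F], 6 ≤ Module.finrank ℚ F → ∀ (Φ : CMType F) (ι₁ : F →+* ℂ), ι₁ ∈ Φ.1 →
      ∀ V : HermSpace3 F ι₁, Thm418AsPrintedC (C F ι₁ V Φ)
        (restOne (C F ι₁ V Φ) (AlgHom.id ℚ F) ι₁ (isConjugateSymplectic_muOfInvType ι₁ Φ) (hasWeight_one_muOfInvType ι₁ Φ) (Def45.Carriers.ofPolDR (muOfInvType ι₁ Φ) (P F ι₁ V Φ))
          (Eps F ι₁ V Φ) (epsOf F ι₁ V Φ) (Chi F ι₁ V Φ) (omega F ι₁ V Φ) (rho F ι₁ V Φ) (rhoΩ F ι₁ V Φ)))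
    (hObj : ∀ (F : CMField) [IsGalois ℚ F], 6 ≤ Module.finrank ℚ F → ∀ (Φ : CMType F) (ι₁ : F →+* ℂ), ι₁ ∈ Φ.1 →
      ∀ V : HermSpace3 F ι₁,
        Nonempty (Def45.CMDatum (AlgHom.id ℚ F) ι₁ (isConjugateSymplectic_muOfInvType ι₁ Φ) (hasWeight_one_muOfInvType ι₁ Φ) (Def45.Carriers.ofPolDR (muOfInvType ι₁ Φ) (P F ι₁ V Φ))))
    (hChi : ∀ (F : CMField), IsGalois ℚ F → 6 ≤ Module.finrank ℚ F → ∀ (Φ : CMType F) (ι₁ : F →+* ℂ), ι₁ ∈ Φ.1 →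
      ∀ V : HermSpace3 F ι₁, Nonempty (Chi F ι₁ V Φ))
    (hirr : ∀ (F : CMField) [IsGalois ℚ F], 6 ≤ Module.finrank ℚ F → ∀ (Φ : CMType F) (ι₁ : F →+* ℂ), ι₁ ∈ Φ.1 →
      ∀ (V : HermSpace3 F ι₁)
        (i : (toThm418Data (C F ι₁ V Φ)
          (restOne (C F ι₁ V Φ) (AlgHom.id ℚ F) ι₁ (isConjugateSymplectic_muOfInvType ι₁ Φ) (hasWeight_one_muOfInvType ι₁ Φ) (Def45.Carriers.ofPolDR (muOfInvType ι₁ Φ) (P F ι₁ V Φ))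
            (Eps F ι₁ V Φ) (epsOf F ι₁ V Φ) (Chi F ι₁ V Φ) (omega F ι₁ V Φ) (rho F ι₁ V Φ) (rhoΩ F ι₁ V Φ))).AdmIndex),
        (rho F ι₁ V Φ i.1.1 i.1.2).IsIrreducible)
    (hsm : ∀ (F : CMField) [IsGalois ℚ F], 6 ≤ Module.finrank ℚ F → ∀ (Φ : CMType F) (ι₁ : F →+* ℂ), ι₁ ∈ Φ.1 →
      ∀ (V : HermSpace3 F ι₁)
        (i : (toThm418Data (C F ι₁ V Φ)
          (restOne (C F ι₁ V Φ) (AlgHom.id ℚ F) ι₁ (isConjugateSymplectic_muOfInvType ι₁ Φ) (hasWeight_one_muOfInvType ι₁ Φ) (Def45.Carriers.ofPolDR (muOfInvType ι₁ Φ) (P F ι₁ V Φ))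
            (Eps F ι₁ V Φ) (epsOf F ι₁ V Φ) (Chi F ι₁ V Φ) (omega F ι₁ V Φ) (rho F ι₁ V Φ) (rhoΩ F ι₁ V Φ))).AdmIndex)
        (v : omega F ι₁ V Φ i.1.1 i.1.2),
        ∃ S : Subgroup (C F ι₁ V Φ).G, IsOpen (S : Set (C F ι₁ V Φ).G) ∧ ∀ k ∈ S, rho F ι₁ V Φ i.1.1 i.1.2 k v = v) :
    (picardCMUniverse hHD hI h₁ h₃).FaceSupply := by
  classical
  -- THE CARRIER FAMILY fed to the unguarded junction: `restOne …` on the Galois branch; on the other branch an inert rest with EMPTY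
  -- object and character types (never read: every hypothesis of the junction is guarded by `IsGalois ℚ F`)
  let R : ∀ (F : CMField) (ι₁ : F →+* ℂ) (V : HermSpace3 F ι₁) (Φ : CMType F), Thm418Rest (C F ι₁ V Φ) := fun F ι₁ V Φ =>
    if hG : IsGalois ℚ F then
      restOne (C F ι₁ V Φ) (AlgHom.id ℚ F) ι₁ (isConjugateSymplectic_muOfInvType ι₁ Φ) (hasWeight_one_muOfInvType ι₁ Φ) (Def45.Carriers.ofPolDR (muOfInvType ι₁ Φ) (P F ι₁ V Φ))
        (Eps F ι₁ V Φ) (epsOf F ι₁ V Φ) (Chi F ι₁ V Φ) (omega F ι₁ V Φ) (rho F ι₁ V Φ) (rhoΩ F ι₁ V Φ)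
    else
      { Eps := PUnit
        epsOf := fun _ => PUnit.unit
        Chi := PEmpty
        μ := (exists_isConjugateSymplectic_hasCMType (L := F) Φ).choose
        isConjugateSymplectic := (exists_isConjugateSymplectic_hasCMType (L := F) Φ).choose_spec.1
        hasWeight_one := (exists_isConjugateSymplectic_hasCMType (L := F) Φ).choose_spec.2.1
        Obj := PEmpty
        Aμ := fun D => D.elim
        omega := fun _ χ => χ.elim
        instAddCommGroupOmega := fun _ χ => χ.elim
        instModuleOmega := fun _ χ => χ.elim
        rho := fun _ χ => χ.elim
        Ω := PUnit
        rhoΩ := 1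
        res := fun _ D => D.elim
        res_pull := fun _ D => D.elim }
  have hR : ∀ (F : CMField) [hG : IsGalois ℚ F] (ι₁ : F →+* ℂ) (V : HermSpace3 F ι₁) (Φ : CMType F), R F ι₁ V Φ =
      restOne (C F ι₁ V Φ) (AlgHom.id ℚ F) ι₁ (isConjugateSymplectic_muOfInvType ι₁ Φ) (hasWeight_one_muOfInvType ι₁ Φ) (Def45.Carriers.ofPolDR (muOfInvType ι₁ Φ) (P F ι₁ V Φ))
        (Eps F ι₁ V Φ) (epsOf F ι₁ V Φ) (Chi F ι₁ V Φ) (omega F ι₁ V Φ) (rho F ι₁ V Φ) (rhoΩ F ι₁ V Φ) :=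
    fun F hG ι₁ V Φ => dif_pos hG
  -- pin-2's along-junction DIRECTLY (pin-3's `…glue_unif_along` minus its FAN-typed `hAlb`), the reach from TEAM hComp's hA-FREE closed term
  -- `pinReachEpi_closed` (S8 `HComp/PinReachEpi.lean`: `hUnif_holds h` [Deligne 1979] + the THEOREM `hAlbEpi_holds_conj`, jointly-epimorphic Albanese data)
  refine faceSupply_of_thm418AsPrinted_pinned_isog_along hHD hI h₁ h₃
    (fun F ι₁ V Φ => toThm418Data (C F ι₁ V Φ) (R F ι₁ V Φ)) (fun _ ι₁ _ _ => (starRingEnd ℂ).comp ι₁)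
    (fun F ι₁ V Φ Dμ => letI := ((starRingEnd ℂ).comp ι₁).toAlgebra; ((R F ι₁ V Φ).Aμ Dμ).baseChange ℂ)
    ?_ ?_ ?_ ?_ ?_ ?_ ?_ (pinReachEpi_closed h₁ h₃ h iso C R)
  -- THE CITE, Thm. 4.18 as printed, at the rest
  · intro F hG h6 Φ ι₁ hι V
    rw [hR]
    exact hLiu F h6 Φ ι₁ hι V
  -- Prop. 4.6 (1) «nonempty», through s2crux-idea-1's `nonempty_obj_restOne_iff`
  · intro F hG h6 Φ ι₁ hι V
    rw [hR]
    exact (nonempty_obj_restOne_iff (C F ι₁ V Φ) (AlgHom.id ℚ F) ι₁ (isConjugateSymplectic_muOfInvType ι₁ Φ)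
      (hasWeight_one_muOfInvType ι₁ Φ) (Def45.Carriers.ofPolDR (muOfInvType ι₁ Φ) (P F ι₁ V Φ)) (Eps F ι₁ V Φ) (epsOf F ι₁ V Φ) (Chi F ι₁ V Φ) (omega F ι₁ V Φ)
      (rho F ι₁ V Φ) (rhoΩ F ι₁ V Φ)).mpr (hObj F h6 Φ ι₁ hι V)
  -- a character exists
  · intro F hG h6 Φ ι₁ hι V
    rw [hR]
    exact hChi F hG h6 Φ ι₁ hι V
  -- «irreducible»
  · intro F hG h6 Φ ι₁ hι V
    rw [hR]
    exact hirr F h6 Φ ι₁ hι V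
  -- «admissible» (smooth vectors)
  · intro F hG h6 Φ ι₁ hι V
    rw [hR]
    exact hsm F h6 Φ ι₁ hι V
  -- THE CHOICE `Φ_μ = Φ^{*ι₁}` read at `ῑ₁`: own-htheta's theorem for `μ := μ(Φ, ι₁)` (the rest's `μ`, by `rfl`), through tr-prover-2's
  -- `isInverse_starRingEnd_comp_iff`
  · intro F hG h6 Φ ι₁ hι V
    rw [hR]
    exact (Transposition.isInverse_starRingEnd_comp_iff ι₁ Φ _).mpr fun g =>
      thm418Data_comp_mem_cmType_iff_of_mu_eq _ ι₁ Φ rfl g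
  -- THE CM HALF: hcmisog-isog-2's σ-parametric Core theorem at `σ := ῑ₁` with the PROJECTIONS of the chosen Def. 4.5 (2) datum, and the
  -- first bullet moved from `ῑ₁` to `ι₁` by `Def45.eta_starRingEnd_comp_apply`
  · intro F hG h6 Φ ι₁ hι V
    rw [hR]
    intro Dμ incl hincl
    exact exists_isogeny_isCMTypeRealisation_baseChange_of_det45 cotangent_hodge10_comparison_holds
      (fun _ _ L _ _ _ u => AbelianVariety.det_cotangentMap_baseChange L u)
      ((starRingEnd ℂ).comp ι₁) (isConjugateSymplectic_muOfInvType ι₁ Φ)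
      (AμOne (AlgHom.id ℚ F) ι₁ (isConjugateSymplectic_muOfInvType ι₁ Φ) (hasWeight_one_muOfInvType ι₁ Φ) (Def45.Carriers.ofPolDR (muOfInvType ι₁ Φ) (P F ι₁ V Φ)) Dμ)
      (iOne (AlgHom.id ℚ F) ι₁ (isConjugateSymplectic_muOfInvType ι₁ Φ) (hasWeight_one_muOfInvType ι₁ Φ) (Def45.Carriers.ofPolDR (muOfInvType ι₁ Φ) (P F ι₁ V Φ)) Dμ)
      (hdimOne (AlgHom.id ℚ F) ι₁ (isConjugateSymplectic_muOfInvType ι₁ Φ) (hasWeight_one_muOfInvType ι₁ Φ) (Def45.Carriers.ofPolDR (muOfInvType ι₁ Φ) (P F ι₁ V Φ)) Dμ)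
      (fun x M f hM hx => by
        rw [Def45.eta_starRingEnd_comp_apply]
        exact hdet45One (AlgHom.id ℚ F) ι₁ (isConjugateSymplectic_muOfInvType ι₁ Φ) (hasWeight_one_muOfInvType ι₁ Φ) (Def45.Carriers.ofPolDR (muOfInvType ι₁ Φ) (P F ι₁ V Φ))
          Dμ x M f hM hx)
      incl hincl

/-! ## §0H  The Hecke layer on §0 (p320155 §1 minus `hA`): `rhoΩ` READ from Hecke translates `T`, at GENERIC carriers -/
/-- **B01-S at `R := restOne …` with `Ω(μ)` carrying THE HECKE ACTION, WITHOUT the Albanese cite**: hcomp-shimura's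
`faceSupply_of_thm418AsPrinted_along_conj_holds_restOne_hecke` (p320155 §1) with the binder `hA` DELETED — statement otherwise VERBATIM, proof VERBATIM
(the total family `rhoΩ' := if h6 : 6 ≤ [F:ℚ] then (T F ι₁ V Φ h6).rhoΩOne … else 1`, `rw [dif_pos h6]` inside `hLiu`/`hirr`/`hsm` — the transport at the
GENERIC carriers, never at the ω terms) re-pointed at §0.  HC_CM is NOT proved: no hypothesis is inhabited here.
[cite: Liu2021, Thm. 4.18 (FJcycle.tex l. 2232–2245), Def. 4.16 l. 2218–2224, §4.2 l. 2070–2074] [cite: Milne2005ShimuraVarieties, Def. 12.10 (a) p. 115; Thm. 13.6 p. 118] -/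
theorem faceSupply_of_thm418AsPrinted_along_conj_holds_restOne_hecke_epi
    (hHD : exists_isReal_hodgeModel) (hI : hodgePQ_independent_of_hodgeModel)
    (h₁ : BallQuotientUniformised) (h₃ : CMAbelianVarietyRealised)
    (h : exists_recordSystem)
    (iso : ∀ (F : CMField) (ι₁ : F →+* ℂ) (_ : HermSpace3 F ι₁) (_ : CMType F), ℕ → Prop)
    (C : ∀ (F : CMField) (ι₁ : F →+* ℂ) (V : HermSpace3 F ι₁) (Φ : CMType F), Sec42Data (honestP5Of h F ι₁ V Φ) (iso F ι₁ V Φ))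
    (P : ∀ (F : CMField) [IsGalois ℚ F] (ι₁ : F →+* ℂ) (_ : HermSpace3 F ι₁) (Φ : CMType F) (A : AbelianVariety F),
      (muAlgValueField F (muOfInvType ι₁ Φ) →+* A.endAlgebra) → Type)
    (Eps : ∀ (F : CMField) (ι₁ : F →+* ℂ) (_ : HermSpace3 F ι₁) (_ : CMType F), Type)
    (epsOf : ∀ (F : CMField) (ι₁ : F →+* ℂ) (V : HermSpace3 F ι₁) (Φ : CMType F), F → Eps F ι₁ V Φ)
    (Chi : ∀ (F : CMField) (ι₁ : F →+* ℂ) (_ : HermSpace3 F ι₁) (_ : CMType F), Type)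
    (omega : ∀ (F : CMField) (ι₁ : F →+* ℂ) (V : HermSpace3 F ι₁) (Φ : CMType F), Eps F ι₁ V Φ → Chi F ι₁ V Φ → Type)
    [instACG : ∀ (F : CMField) (ι₁ : F →+* ℂ) (V : HermSpace3 F ι₁) (Φ : CMType F) (ε : Eps F ι₁ V Φ) (χ : Chi F ι₁ V Φ),
      AddCommGroup (omega F ι₁ V Φ ε χ)]
    [instMod : ∀ (F : CMField) (ι₁ : F →+* ℂ) (V : HermSpace3 F ι₁) (Φ : CMType F) (ε : Eps F ι₁ V Φ) (χ : Chi F ι₁ V Φ),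
      Module ℂ (omega F ι₁ V Φ ε χ)]
    (rho : ∀ (F : CMField) (ι₁ : F →+* ℂ) (V : HermSpace3 F ι₁) (Φ : CMType F) (ε : Eps F ι₁ V Φ) (χ : Chi F ι₁ V Φ),
      Representation ℂ (C F ι₁ V Φ).G (omega F ι₁ V Φ ε χ))
    (T : ∀ (F : CMField) (ι₁ : F →+* ℂ) (V : HermSpace3 F ι₁) (Φ : CMType F), 6 ≤ Module.finrank ℚ F →
      (C F ι₁ V Φ).HeckeTranslates)
    (hLiu : ∀ (F : CMField) [IsGalois ℚ F] (h6 : 6 ≤ Module.finrank ℚ F) (Φ : CMType F) (ι₁ : F →+* ℂ), ι₁ ∈ Φ.1 →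
      ∀ V : HermSpace3 F ι₁, Thm418AsPrintedC (C F ι₁ V Φ)
        (restOne (C F ι₁ V Φ) (AlgHom.id ℚ F) ι₁ (isConjugateSymplectic_muOfInvType ι₁ Φ) (hasWeight_one_muOfInvType ι₁ Φ) (Def45.Carriers.ofPolDR (muOfInvType ι₁ Φ) (P F ι₁ V Φ))
          (Eps F ι₁ V Φ) (epsOf F ι₁ V Φ) (Chi F ι₁ V Φ) (omega F ι₁ V Φ) (rho F ι₁ V Φ) ((T F ι₁ V Φ h6).rhoΩOne (AlgHom.id ℚ F) ι₁ (isConjugateSymplectic_muOfInvType ι₁ Φ) (hasWeight_one_muOfInvType ι₁ Φ) (Def45.Carriers.ofPolDR (muOfInvType ι₁ Φ) (P F ι₁ V Φ)))))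
    (hObj : ∀ (F : CMField) [IsGalois ℚ F], 6 ≤ Module.finrank ℚ F → ∀ (Φ : CMType F) (ι₁ : F →+* ℂ), ι₁ ∈ Φ.1 →
      ∀ V : HermSpace3 F ι₁,
        Nonempty (Def45.CMDatum (AlgHom.id ℚ F) ι₁ (isConjugateSymplectic_muOfInvType ι₁ Φ) (hasWeight_one_muOfInvType ι₁ Φ) (Def45.Carriers.ofPolDR (muOfInvType ι₁ Φ) (P F ι₁ V Φ))))
    (hChi : ∀ (F : CMField), IsGalois ℚ F → 6 ≤ Module.finrank ℚ F → ∀ (Φ : CMType F) (ι₁ : F →+* ℂ), ι₁ ∈ Φ.1 →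
      ∀ V : HermSpace3 F ι₁, Nonempty (Chi F ι₁ V Φ))
    (hirr : ∀ (F : CMField) [IsGalois ℚ F] (h6 : 6 ≤ Module.finrank ℚ F) (Φ : CMType F) (ι₁ : F →+* ℂ), ι₁ ∈ Φ.1 →
      ∀ (V : HermSpace3 F ι₁)
        (i : (toThm418Data (C F ι₁ V Φ)
          (restOne (C F ι₁ V Φ) (AlgHom.id ℚ F) ι₁ (isConjugateSymplectic_muOfInvType ι₁ Φ) (hasWeight_one_muOfInvType ι₁ Φ) (Def45.Carriers.ofPolDR (muOfInvType ι₁ Φ) (P F ι₁ V Φ))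
            (Eps F ι₁ V Φ) (epsOf F ι₁ V Φ) (Chi F ι₁ V Φ) (omega F ι₁ V Φ) (rho F ι₁ V Φ) ((T F ι₁ V Φ h6).rhoΩOne (AlgHom.id ℚ F) ι₁ (isConjugateSymplectic_muOfInvType ι₁ Φ) (hasWeight_one_muOfInvType ι₁ Φ) (Def45.Carriers.ofPolDR (muOfInvType ι₁ Φ) (P F ι₁ V Φ))))).AdmIndex),
        (rho F ι₁ V Φ i.1.1 i.1.2).IsIrreducible)
    (hsm : ∀ (F : CMField) [IsGalois ℚ F] (h6 : 6 ≤ Module.finrank ℚ F) (Φ : CMType F) (ι₁ : F →+* ℂ), ι₁ ∈ Φ.1 →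
      ∀ (V : HermSpace3 F ι₁)
        (i : (toThm418Data (C F ι₁ V Φ)
          (restOne (C F ι₁ V Φ) (AlgHom.id ℚ F) ι₁ (isConjugateSymplectic_muOfInvType ι₁ Φ) (hasWeight_one_muOfInvType ι₁ Φ) (Def45.Carriers.ofPolDR (muOfInvType ι₁ Φ) (P F ι₁ V Φ))
            (Eps F ι₁ V Φ) (epsOf F ι₁ V Φ) (Chi F ι₁ V Φ) (omega F ι₁ V Φ) (rho F ι₁ V Φ) ((T F ι₁ V Φ h6).rhoΩOne (AlgHom.id ℚ F) ι₁ (isConjugateSymplectic_muOfInvType ι₁ Φ) (hasWeight_one_muOfInvType ι₁ Φ) (Def45.Carriers.ofPolDR (muOfInvType ι₁ Φ) (P F ι₁ V Φ))))).AdmIndex)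
        (v : omega F ι₁ V Φ i.1.1 i.1.2),
        ∃ S : Subgroup (C F ι₁ V Φ).G, IsOpen (S : Set (C F ι₁ V Φ).G) ∧ ∀ k ∈ S, rho F ι₁ V Φ i.1.1 i.1.2 k v = v) :
    (picardCMUniverse hHD hI h₁ h₃).FaceSupply := by
  classical
  -- the first re-cut's total family `rhoΩ`, INSTANTIATED from the Hecke translates on the `6 ≤ [F:ℚ]` branch (the only branch read)
  let rhoΩ' : ∀ (F : CMField) [IsGalois ℚ F] (ι₁ : F →+* ℂ) (V : HermSpace3 F ι₁) (Φ : CMType F),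
      Representation (fieldOfValues F (muOfInvType ι₁ Φ)) (C F ι₁ V Φ).G
        (ΩOne (C F ι₁ V Φ) (AlgHom.id ℚ F) ι₁ (isConjugateSymplectic_muOfInvType ι₁ Φ) (hasWeight_one_muOfInvType ι₁ Φ)
          (Def45.Carriers.ofPolDR (muOfInvType ι₁ Φ) (P F ι₁ V Φ))) := fun F _ ι₁ V Φ =>
    if h6 : 6 ≤ Module.finrank ℚ F then
      (T F ι₁ V Φ h6).rhoΩOne (AlgHom.id ℚ F) ι₁ (isConjugateSymplectic_muOfInvType ι₁ Φ) (hasWeight_one_muOfInvType ι₁ Φ)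
        (Def45.Carriers.ofPolDR (muOfInvType ι₁ Φ) (P F ι₁ V Φ))
    else 1
  have hρ : ∀ (F : CMField) [IsGalois ℚ F] (ι₁ : F →+* ℂ) (V : HermSpace3 F ι₁) (Φ : CMType F) (h6 : 6 ≤ Module.finrank ℚ F),
      rhoΩ' F ι₁ V Φ =
        (T F ι₁ V Φ h6).rhoΩOne (AlgHom.id ℚ F) ι₁ (isConjugateSymplectic_muOfInvType ι₁ Φ) (hasWeight_one_muOfInvType ι₁ Φ)
          (Def45.Carriers.ofPolDR (muOfInvType ι₁ Φ) (P F ι₁ V Φ)) := fun F _ ι₁ V Φ h6 => dif_pos h6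
  refine faceSupply_of_thm418AsPrinted_along_conj_holds_restOne_epi hHD hI h₁ h₃ h iso C P Eps epsOf Chi omega rho rhoΩ'
    ?_ hObj hChi ?_ ?_
  · intro F hG h6 Φ ι₁ hι V
    rw [hρ F ι₁ V Φ h6]
    exact hLiu F h6 Φ ι₁ hι V
  · intro F hG h6 Φ ι₁ hι V
    rw [hρ F ι₁ V Φ h6]
    exact hirr F h6 Φ ι₁ hι V
  · intro F hG h6 Φ ι₁ hι V
    rw [hρ F ι₁ V Φ h6]
    exact hsm F h6 Φ ι₁ hι V

/-! ## §1  B01-S with EVERY carrier CONSTRUCTED and NO Albanese cite (§0H at the ladder's plugs; BUILT-R §1 minus `hAb`) -/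

/-- **B01-S from [Liu2021, Thm. 4.18] with every Liu carrier CONSTRUCTED and the Albanese cite RETIRED** (`U = picardCMUniverse hHD hI h₁ h₃`): §0H at
`iso := isoOf`, `C := sec42DataOf h isoOf` (pin-1, `HComp/Sec42DataOf.lean`), `P := Def45.PolDR ι₁ _ (Def45.RMuForm ι₁ _)` (pin-2), the Def. 4.11 carriers
`Def411WeilCarriers.{Eps, epsOf, Chi, omega, rho}` at the χ_μ-attached splitting `OmegaMuSplitting.hsMu` (item6-p3 / mc-theta-3), `T := heckeTranslatesFamilyOf heckeTranslate_definedOver_holds h isoOf` (hcomp-shimura, `HComp/HeckeTranslatesOfSec42DataOf.lean`), `hObj :=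
Def45.nonempty_cmDatum_polarised_of_casselman' … h21 (Def45.RMuForm …) Def45.rMuForm_nonempty`, `hChi := Def411WeilCarriers.nonempty_chi`, `hsm :=
Def411WeilCarriers.rho_smooth … OmegaMuSplitting.hscMu` — every plug the SAME tree name the ladder used at that position — ONE APPLICATION
(all displayed types agree after β/δ).  Statement = BUILT-R §1's with the binder
`hAb` deleted.  Displayed: the cites `h` ([Deligne1979] 2.1.2/2.2.5), `h21` ([Shimura1998] Thm. 21.4), `hLiu` ([Liu2021] Thm. 4.18 at the constructed
system/objects/action), the reading `hirr` (Def. 4.11 / Lem. D.1 (1)); NO data, NO Albanese cite.  HC_CM is NOT proved; none of the hypotheses is inhabited here.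
[cite: Liu2021, Thm. 4.18 (FJcycle.tex l. 2232–2245), §4.2 l. 2053–2074, §2.1 Prop. 2.2, Prop. 4.6 (1), Def. 4.5 (2), Def. 4.11–4.12] [cite: Milne2005ShimuraVarieties, Thm. 13.6 p. 118]
[cite: Shimura1998, §21.4 Thm. 21.4] [cite: Deligne1979ShimuraVarieties, §2.1.2, 2.2.5 and Cor. 2.7.21] -/
theorem faceSupply_of_thm418AsPrinted_along_conj_holds_restOne_builtEpi
    (hHD : exists_isReal_hodgeModel) (hI : hodgePQ_independent_of_hodgeModel)
    (h₁ : BallQuotientUniformised) (h₃ : CMAbelianVarietyRealised)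
    (h : exists_recordSystem)
    (hLiu : ∀ (F : CMField) [IsGalois ℚ F] (h6 : 6 ≤ Module.finrank ℚ F) (Φ : CMType F) (ι₁ : F →+* ℂ), ι₁ ∈ Φ.1 →
      ∀ V : HermSpace3 F ι₁, Thm418AsPrintedC (sec42DataOf h isoOf F ι₁ V Φ)
        (restOne (sec42DataOf h isoOf F ι₁ V Φ) (AlgHom.id ℚ F) ι₁ (isConjugateSymplectic_muOfInvType ι₁ Φ) (hasWeight_one_muOfInvType ι₁ Φ) (Def45.Carriers.ofPolDR (muOfInvType ι₁ Φ) (Def45.PolDR ι₁ (isConjugateSymplectic_muOfInvType ι₁ Φ) (Def45.RMuForm ι₁ (isConjugateSymplectic_muOfInvType ι₁ Φ))))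
            (Def411WeilCarriers.Eps ↥(maximalRealSubfield F) (imagUnitSq F)) (Def411WeilCarriers.epsOf ↥(maximalRealSubfield F) (imagUnitSq F) F (imagUnit F)) (Def411WeilCarriers.Chi ↥(maximalRealSubfield F) F (IsCMField.complexConj F))
            (Def411WeilCarriers.omega ↥(maximalRealSubfield F) F (IsCMField.complexConj F) 3 finProdFinEquiv (Matrix.diagonal V.diagEntries) (complexConj_imagUnit F) (imagUnit_ne_zero F) (imagUnit_mul_self F) (realDiagonal_isSymm F V.diagEntries V.complexConj_diagEntries) (isUnit_det_realDiagonal F V.diagEntries V.complexConj_diagEntries V.diagEntries_ne_zero) (realDiagonal_map F V.diagEntries V.complexConj_diagEntries).symm (OmegaMuSplitting.hsMu F ι₁ V Φ))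
            (Def411WeilCarriers.rho ↥(maximalRealSubfield F) F (IsCMField.complexConj F) 3 finProdFinEquiv (Matrix.diagonal V.diagEntries) (complexConj_imagUnit F) (imagUnit_ne_zero F) (imagUnit_mul_self F) (realDiagonal_isSymm F V.diagEntries V.complexConj_diagEntries) (isUnit_det_realDiagonal F V.diagEntries V.complexConj_diagEntries V.diagEntries_ne_zero) (realDiagonal_map F V.diagEntries V.complexConj_diagEntries).symm (OmegaMuSplitting.hsMu F ι₁ V Φ) V.adelicFinDiag.toMulEquiv.toMonoidHom) ((heckeTranslatesFamilyOf heckeTranslate_definedOver_holds h isoOf F ι₁ V Φ h6).rhoΩOne (AlgHom.id ℚ F) ι₁ (isConjugateSymplectic_muOfInvType ι₁ Φ) (hasWeight_one_muOfInvType ι₁ Φ) (Def45.Carriers.ofPolDR (muOfInvType ι₁ Φ) (Def45.PolDR ι₁ (isConjugateSymplectic_muOfInvType ι₁ Φ) (Def45.RMuForm ι₁ (isConjugateSymplectic_muOfInvType ι₁ Φ)))))))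
    (h21 : shimura1998_thm21_4_casselman)
    (hirr : ∀ (F : CMField) [IsGalois ℚ F] (h6 : 6 ≤ Module.finrank ℚ F) (Φ : CMType F) (ι₁ : F →+* ℂ), ι₁ ∈ Φ.1 →
      ∀ (V : HermSpace3 F ι₁)
        (i : (toThm418Data (sec42DataOf h isoOf F ι₁ V Φ)
          (restOne (sec42DataOf h isoOf F ι₁ V Φ) (AlgHom.id ℚ F) ι₁ (isConjugateSymplectic_muOfInvType ι₁ Φ) (hasWeight_one_muOfInvType ι₁ Φ) (Def45.Carriers.ofPolDR (muOfInvType ι₁ Φ) (Def45.PolDR ι₁ (isConjugateSymplectic_muOfInvType ι₁ Φ) (Def45.RMuForm ι₁ (isConjugateSymplectic_muOfInvType ι₁ Φ))))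
            (Def411WeilCarriers.Eps ↥(maximalRealSubfield F) (imagUnitSq F)) (Def411WeilCarriers.epsOf ↥(maximalRealSubfield F) (imagUnitSq F) F (imagUnit F)) (Def411WeilCarriers.Chi ↥(maximalRealSubfield F) F (IsCMField.complexConj F))
            (Def411WeilCarriers.omega ↥(maximalRealSubfield F) F (IsCMField.complexConj F) 3 finProdFinEquiv (Matrix.diagonal V.diagEntries) (complexConj_imagUnit F) (imagUnit_ne_zero F) (imagUnit_mul_self F) (realDiagonal_isSymm F V.diagEntries V.complexConj_diagEntries) (isUnit_det_realDiagonal F V.diagEntries V.complexConj_diagEntries V.diagEntries_ne_zero) (realDiagonal_map F V.diagEntries V.complexConj_diagEntries).symm (OmegaMuSplitting.hsMu F ι₁ V Φ))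
            (Def411WeilCarriers.rho ↥(maximalRealSubfield F) F (IsCMField.complexConj F) 3 finProdFinEquiv (Matrix.diagonal V.diagEntries) (complexConj_imagUnit F) (imagUnit_ne_zero F) (imagUnit_mul_self F) (realDiagonal_isSymm F V.diagEntries V.complexConj_diagEntries) (isUnit_det_realDiagonal F V.diagEntries V.complexConj_diagEntries V.diagEntries_ne_zero) (realDiagonal_map F V.diagEntries V.complexConj_diagEntries).symm (OmegaMuSplitting.hsMu F ι₁ V Φ) V.adelicFinDiag.toMulEquiv.toMonoidHom) ((heckeTranslatesFamilyOf heckeTranslate_definedOver_holds h isoOf F ι₁ V Φ h6).rhoΩOne (AlgHom.id ℚ F) ι₁ (isConjugateSymplectic_muOfInvType ι₁ Φ) (hasWeight_one_muOfInvType ι₁ Φ) (Def45.Carriers.ofPolDR (muOfInvType ι₁ Φ) (Def45.PolDR ι₁ (isConjugateSymplectic_muOfInvType ι₁ Φ) (Def45.RMuForm ι₁ (isConjugateSymplectic_muOfInvType ι₁ Φ))))))).AdmIndex),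
        (Def411WeilCarriers.rho ↥(maximalRealSubfield F) F (IsCMField.complexConj F) 3 finProdFinEquiv (Matrix.diagonal V.diagEntries) (complexConj_imagUnit F) (imagUnit_ne_zero F) (imagUnit_mul_self F) (realDiagonal_isSymm F V.diagEntries V.complexConj_diagEntries) (isUnit_det_realDiagonal F V.diagEntries V.complexConj_diagEntries V.diagEntries_ne_zero) (realDiagonal_map F V.diagEntries V.complexConj_diagEntries).symm (OmegaMuSplitting.hsMu F ι₁ V Φ) V.adelicFinDiag.toMulEquiv.toMonoidHom i.1.1 i.1.2).IsIrreducible) :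
    (picardCMUniverse hHD hI h₁ h₃).FaceSupply :=
  -- §0H at EVERY remaining plug, by the SAME tree names (Omega p320321 / union p321050 / PLUGGED p323209 / PLUGGED-R p325278 / BUILT-R) — ONE APPLICATION (β/δ only)
  faceSupply_of_thm418AsPrinted_along_conj_holds_restOne_hecke_epi hHD hI h₁ h₃ h isoOf (sec42DataOf h isoOf)
    -- Def. 4.5 (2) bullets 3–4: `PolDR` at pin-2's de Rham form `RMuForm` (PLUGGED / PLUGGED-R)
    (fun _ _ ι₁ _ Φ => Def45.PolDR ι₁ (isConjugateSymplectic_muOfInvType ι₁ Φ) (Def45.RMuForm ι₁ (isConjugateSymplectic_muOfInvType ι₁ Φ)))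
    -- Def. 4.11 Weil carriers at the χ_μ-attached splitting `OmegaMuSplitting.sMu/hsMu` (Omega p320321 / PLUGGED)
    (fun F _ _ _ => Def411WeilCarriers.Eps ↥(maximalRealSubfield F) (imagUnitSq F))
    (fun F _ _ _ => Def411WeilCarriers.epsOf ↥(maximalRealSubfield F) (imagUnitSq F) F (imagUnit F))
    (fun F _ _ _ => Def411WeilCarriers.Chi ↥(maximalRealSubfield F) F (IsCMField.complexConj F))
    (fun F ι₁ V Φ => Def411WeilCarriers.omega ↥(maximalRealSubfield F) F (IsCMField.complexConj F) 3 finProdFinEquiv (Matrix.diagonal V.diagEntries) (complexConj_imagUnit F) (imagUnit_ne_zero F) (imagUnit_mul_self F) (realDiagonal_isSymm F V.diagEntries V.complexConj_diagEntries) (isUnit_det_realDiagonal F V.diagEntries V.complexConj_diagEntries V.diagEntries_ne_zero) (realDiagonal_map F V.diagEntries V.complexConj_diagEntries).symm (OmegaMuSplitting.hsMu F ι₁ V Φ))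
    (fun F ι₁ V Φ => Def411WeilCarriers.rho ↥(maximalRealSubfield F) F (IsCMField.complexConj F) 3 finProdFinEquiv (Matrix.diagonal V.diagEntries) (complexConj_imagUnit F) (imagUnit_ne_zero F) (imagUnit_mul_self F) (realDiagonal_isSymm F V.diagEntries V.complexConj_diagEntries) (isUnit_det_realDiagonal F V.diagEntries V.complexConj_diagEntries V.diagEntries_ne_zero) (realDiagonal_map F V.diagEntries V.complexConj_diagEntries).symm (OmegaMuSplitting.hsMu F ι₁ V Φ) V.adelicFinDiag.toMulEquiv.toMonoidHom)
    -- the Hecke translates of the canonical-model record, CONSTRUCTED (BUILT-R)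
    (heckeTranslatesFamilyOf heckeTranslate_definedOver_holds h isoOf) hLiu
    -- Prop. 4.6 (1) «𝒜(μ) ≠ ∅» from Casselman's theorem `h21` at the de Rham form (PLUGGED / PLUGGED-R)
    (fun _ _ _ Φ ι₁ _ _ => Def45.nonempty_cmDatum_polarised_of_casselman' ι₁ (isConjugateSymplectic_muOfInvType ι₁ Φ)
      (hasWeight_one_muOfInvType ι₁ Φ) h21 (Def45.RMuForm ι₁ (isConjugateSymplectic_muOfInvType ι₁ Φ))
      (fun A i => Def45.rMuForm_nonempty ι₁ (isConjugateSymplectic_muOfInvType ι₁ Φ) A i))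
    -- a character exists: the trivial one (Omega p320321)
    (fun F _ _ _ _ _ _ => Def411WeilCarriers.nonempty_chi ↥(maximalRealSubfield F) F (IsCMField.complexConj F))
    hirr
    -- «admissible»: smooth vectors (Omega p320321)
    (fun F _ _ Φ ι₁ _ V i v =>
      Def411WeilCarriers.rho_smooth ↥(maximalRealSubfield F) F (IsCMField.complexConj F) 3 finProdFinEquiv (Matrix.diagonal V.diagEntries) (complexConj_imagUnit F) (imagUnit_ne_zero F) (imagUnit_mul_self F) (realDiagonal_isSymm F V.diagEntries V.complexConj_diagEntries) (isUnit_det_realDiagonal F V.diagEntries V.complexConj_diagEntries V.diagEntries_ne_zero) (realDiagonal_map F V.diagEntries V.complexConj_diagEntries).symm (OmegaMuSplitting.hsMu F ι₁ V Φ)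
        V.adelicFinDiag.toMulEquiv.toMonoidHom V.continuous_adelicFinDiag_toMonoidHom (OmegaMuSplitting.hscMu F ι₁ V Φ) i.1.1 i.1.2 v)

/-! ## §2  THE (β)-FREE END DISPLAY, MEETING FORM, on the universe of record — 4 NAMED + hM -/

section MeetingFormBuiltEpi

open MeasureTheory
open Prior.Perl34File (Perl34.IsolationSetting)
open Prior.Perl34File.Perl34

/-- **END DISPLAY, (β)-FREE MEETING FORM, on the universe OF RECORD, every Liu carrier CONSTRUCTED, NO Albanese cite** (`let U := U_rec`): §1 composed BY
NAME with `hc_cm_of_supply_of_settingMeetSat_embOf` at the four `_holds` data and `deligneMilne1982_Thm_6_20_full_holds`, exactly as p317049 §2.  Statement =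
BUILT-R §2's with the binder `hAb` deleted.  Displayed hypotheses = cites {`h`, `h21`, `hLiu`} · reading {`hirr`} · NO data + the theta-side meeting binder `hM`
(b01-x2's text VERBATIM at `U_rec`) = 4 NAMED + hM.  HC_CM is NOT proved: no hypothesis is inhabited here.
[cite: Liu2021, Thm. 4.18 (FJcycle.tex l. 2232–2245), §2.1 Prop. 2.2, Prop. 4.6 (1), Def. 4.5 (2), Def. 4.11–4.12] [cite: Milne2005ShimuraVarieties, Thm. 13.6 p. 118]
[cite: Shimura1998, §21.4 Thm. 21.4] [cite: Deligne1979ShimuraVarieties, §2.1.2, 2.2.5 and Cor. 2.7.21] -/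
theorem hc_cm_of_thm418AsPrinted_along_conj_holds_restOne_builtEpi_meeting_rec
    (h : exists_recordSystem)
    (hLiu : ∀ (F : CMField) [IsGalois ℚ F] (h6 : 6 ≤ Module.finrank ℚ F) (Φ : CMType F) (ι₁ : F →+* ℂ), ι₁ ∈ Φ.1 →
      ∀ V : HermSpace3 F ι₁, Thm418AsPrintedC (sec42DataOf h isoOf F ι₁ V Φ)
        (restOne (sec42DataOf h isoOf F ι₁ V Φ) (AlgHom.id ℚ F) ι₁ (isConjugateSymplectic_muOfInvType ι₁ Φ) (hasWeight_one_muOfInvType ι₁ Φ) (Def45.Carriers.ofPolDR (muOfInvType ι₁ Φ) (Def45.PolDR ι₁ (isConjugateSymplectic_muOfInvType ι₁ Φ) (Def45.RMuForm ι₁ (isConjugateSymplectic_muOfInvType ι₁ Φ))))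
            (Def411WeilCarriers.Eps ↥(maximalRealSubfield F) (imagUnitSq F)) (Def411WeilCarriers.epsOf ↥(maximalRealSubfield F) (imagUnitSq F) F (imagUnit F)) (Def411WeilCarriers.Chi ↥(maximalRealSubfield F) F (IsCMField.complexConj F))
            (Def411WeilCarriers.omega ↥(maximalRealSubfield F) F (IsCMField.complexConj F) 3 finProdFinEquiv (Matrix.diagonal V.diagEntries) (complexConj_imagUnit F) (imagUnit_ne_zero F) (imagUnit_mul_self F) (realDiagonal_isSymm F V.diagEntries V.complexConj_diagEntries) (isUnit_det_realDiagonal F V.diagEntries V.complexConj_diagEntries V.diagEntries_ne_zero) (realDiagonal_map F V.diagEntries V.complexConj_diagEntries).symm (OmegaMuSplitting.hsMu F ι₁ V Φ))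
            (Def411WeilCarriers.rho ↥(maximalRealSubfield F) F (IsCMField.complexConj F) 3 finProdFinEquiv (Matrix.diagonal V.diagEntries) (complexConj_imagUnit F) (imagUnit_ne_zero F) (imagUnit_mul_self F) (realDiagonal_isSymm F V.diagEntries V.complexConj_diagEntries) (isUnit_det_realDiagonal F V.diagEntries V.complexConj_diagEntries V.diagEntries_ne_zero) (realDiagonal_map F V.diagEntries V.complexConj_diagEntries).symm (OmegaMuSplitting.hsMu F ι₁ V Φ) V.adelicFinDiag.toMulEquiv.toMonoidHom) ((heckeTranslatesFamilyOf heckeTranslate_definedOver_holds h isoOf F ι₁ V Φ h6).rhoΩOne (AlgHom.id ℚ F) ι₁ (isConjugateSymplectic_muOfInvType ι₁ Φ) (hasWeight_one_muOfInvType ι₁ Φ) (Def45.Carriers.ofPolDR (muOfInvType ι₁ Φ) (Def45.PolDR ι₁ (isConjugateSymplectic_muOfInvType ι₁ Φ) (Def45.RMuForm ι₁ (isConjugateSymplectic_muOfInvType ι₁ Φ)))))))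
    (h21 : shimura1998_thm21_4_casselman)
    (hirr : ∀ (F : CMField) [IsGalois ℚ F] (h6 : 6 ≤ Module.finrank ℚ F) (Φ : CMType F) (ι₁ : F →+* ℂ), ι₁ ∈ Φ.1 →
      ∀ (V : HermSpace3 F ι₁)
        (i : (toThm418Data (sec42DataOf h isoOf F ι₁ V Φ)
          (restOne (sec42DataOf h isoOf F ι₁ V Φ) (AlgHom.id ℚ F) ι₁ (isConjugateSymplectic_muOfInvType ι₁ Φ) (hasWeight_one_muOfInvType ι₁ Φ) (Def45.Carriers.ofPolDR (muOfInvType ι₁ Φ) (Def45.PolDR ι₁ (isConjugateSymplectic_muOfInvType ι₁ Φ) (Def45.RMuForm ι₁ (isConjugateSymplectic_muOfInvType ι₁ Φ))))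
            (Def411WeilCarriers.Eps ↥(maximalRealSubfield F) (imagUnitSq F)) (Def411WeilCarriers.epsOf ↥(maximalRealSubfield F) (imagUnitSq F) F (imagUnit F)) (Def411WeilCarriers.Chi ↥(maximalRealSubfield F) F (IsCMField.complexConj F))
            (Def411WeilCarriers.omega ↥(maximalRealSubfield F) F (IsCMField.complexConj F) 3 finProdFinEquiv (Matrix.diagonal V.diagEntries) (complexConj_imagUnit F) (imagUnit_ne_zero F) (imagUnit_mul_self F) (realDiagonal_isSymm F V.diagEntries V.complexConj_diagEntries) (isUnit_det_realDiagonal F V.diagEntries V.complexConj_diagEntries V.diagEntries_ne_zero) (realDiagonal_map F V.diagEntries V.complexConj_diagEntries).symm (OmegaMuSplitting.hsMu F ι₁ V Φ))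
            (Def411WeilCarriers.rho ↥(maximalRealSubfield F) F (IsCMField.complexConj F) 3 finProdFinEquiv (Matrix.diagonal V.diagEntries) (complexConj_imagUnit F) (imagUnit_ne_zero F) (imagUnit_mul_self F) (realDiagonal_isSymm F V.diagEntries V.complexConj_diagEntries) (isUnit_det_realDiagonal F V.diagEntries V.complexConj_diagEntries V.diagEntries_ne_zero) (realDiagonal_map F V.diagEntries V.complexConj_diagEntries).symm (OmegaMuSplitting.hsMu F ι₁ V Φ) V.adelicFinDiag.toMulEquiv.toMonoidHom) ((heckeTranslatesFamilyOf heckeTranslate_definedOver_holds h isoOf F ι₁ V Φ h6).rhoΩOne (AlgHom.id ℚ F) ι₁ (isConjugateSymplectic_muOfInvType ι₁ Φ) (hasWeight_one_muOfInvType ι₁ Φ) (Def45.Carriers.ofPolDR (muOfInvType ι₁ Φ) (Def45.PolDR ι₁ (isConjugateSymplectic_muOfInvType ι₁ Φ) (Def45.RMuForm ι₁ (isConjugateSymplectic_muOfInvType ι₁ Φ))))))).AdmIndex),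
        (Def411WeilCarriers.rho ↥(maximalRealSubfield F) F (IsCMField.complexConj F) 3 finProdFinEquiv (Matrix.diagonal V.diagEntries) (complexConj_imagUnit F) (imagUnit_ne_zero F) (imagUnit_mul_self F) (realDiagonal_isSymm F V.diagEntries V.complexConj_diagEntries) (isUnit_det_realDiagonal F V.diagEntries V.complexConj_diagEntries V.diagEntries_ne_zero) (realDiagonal_map F V.diagEntries V.complexConj_diagEntries).symm (OmegaMuSplitting.hsMu F ι₁ V Φ) V.adelicFinDiag.toMulEquiv.toMonoidHom i.1.1 i.1.2).IsIrreducible) :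
    let U := picardCMUniverse exists_isReal_hodgeModel_holds hodgePQ_independent_of_hodgeModel_holds
      BallQuotient.ballQuotientUniformised_holds cmAbelianVarietyRealised_holds
    let hU := ballQuotientUniformisedDatum_of BallQuotient.ballQuotientUniformised_holds
    (∀ (F : CMField), IsGalois ℚ F → 6 ≤ Module.finrank ℚ F → ∀ (f : Face F) (ι₁ : F →+* ℂ), f.Admissible ι₁ →
      ∀ V : HermSpace3 F ι₁,
      ∃ (H CG G SK SigIdx SigIdxG : Type) (_ : NormedAddCommGroup H) (_ : InnerProductSpace ℂ H) (_ : CompleteSpace H)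
        (_ : NormedAddCommGroup CG) (_ : NormedSpace ℂ CG) (_ : Group G) (_ : TopologicalSpace G) (_ : TopologicalSpace SK)
        (S : Perl34.IsolationSetting H (Lp ℂ 2 V.autMeasure) CG G SK SigIdx SigIdxG),
        (∀ (Γ : Level V) (ω₁ ω₂ : U.CohC (U.pms F ι₁ V Γ) 1),
          ω₁ ∈ U.Uiso Γ F (f.psi 0) ι₁ → ω₂ ∈ U.Uiso Γ F (f.psi 1) ι₁ →
            embOf exists_isReal_hodgeModel_holds hodgePQ_independent_of_hodgeModel_holds hU cmAbelianVarietyRealised_holds Γ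
                (U.cup2C (U.pms F ι₁ V Γ) 1 ω₁ ω₂) ≠ 0 →
              ∃ u ∈ S.t12.S12,
                ⟪embOf exists_isReal_hodgeModel_holds hodgePQ_independent_of_hodgeModel_holds hU cmAbelianVarietyRealised_holds Γ
                    (U.cup2C (U.pms F ι₁ V Γ) 1 ω₁ ω₂), u⟫_ℂ ≠ 0) ∧
        (∀ χ : S.t34.X, S.t34.allowed χ → ∀ (Φ : SK) (Γ₁ : Level V)
          (ω₁ ω₂ : U.CohC (U.pms F ι₁ V Γ₁) 1),
          ω₁ ∈ U.Uiso Γ₁ F (f.psi 0) ι₁ →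
          ω₂ ∈ U.Uiso Γ₁ F (f.psi 1) ι₁ →
            ⟪embOf exists_isReal_hodgeModel_holds hodgePQ_independent_of_hodgeModel_holds hU cmAbelianVarietyRealised_holds Γ₁
                (U.cup2C (U.pms F ι₁ V Γ₁) 1 ω₁ ω₂),
              S.t34.ϑ χ Φ⟫_ℂ ≠ 0 →
              ∃ (Γ : Level V) (ω : Fin 4 → U.CohC (U.pms F ι₁ V Γ) 1),
                (∀ i, ω i ∈ U.Uiso Γ F (f.psi i) ι₁) ∧
                  ⟪embOf exists_isReal_hodgeModel_holds hodgePQ_independent_of_hodgeModel_holds hU cmAbelianVarietyRealised_holds Γ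
                      (U.cup2C (U.pms F ι₁ V Γ) 1 (ω 2) (ω 3)),
                    embOf exists_isReal_hodgeModel_holds hodgePQ_independent_of_hodgeModel_holds hU cmAbelianVarietyRealised_holds Γ
                      (U.cup2C (U.pms F ι₁ V Γ) 1 (ω 0) (ω 1))⟫_ℂ
                    ≠ 0)) →
    HC_CM :=
  fun hM ↦ hc_cm_of_supply_of_settingMeetSat_embOf exists_isReal_hodgeModel_holds hodgePQ_independent_of_hodgeModel_holds
    BallQuotient.ballQuotientUniformised_holds cmAbelianVarietyRealised_holds deligneMilne1982_Thm_6_20_full_holds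
    (faceSupply_of_thm418AsPrinted_along_conj_holds_restOne_builtEpi _ _ _ _ h hLiu h21 hirr) hM

end MeetingFormBuiltEpi

end Summit.HodgeConjecture.CorCM.Model

end
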